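import Summits.BirchSwinnertonDyer.BirchSwinnertonDyer.Theorems.KatoDescentPotSupersingularKatoFiniteLevelStrictPointCount
import HarnessLib

/-!
# Kato's (14.9.3) at finite level, part 16: the NET statements for THE invariant maps of class field theory
# (`LocalInvariants.canonical K (p^k)`) — Poitou–Tate input reduced to `SelmerComplement` alone
# (route `KatoDescentPotSupersingular` / `…Tame…`, crux M = stmt-BirchSwinnertonDyer-19196 `ReducibleKatoMember`; route-free helper)

Seat `bsd-potss-rkm` g17 (prover; cell `bsd-potss`), item stmt-BirchSwinnertonDyer-19196 (`--supports … --as helper`; closes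
nothing).  HONEST FRAMING: BSD is not proved by any of this; nothing is booked; theorems only (no definition, no named fact).

Parts 9–15 quantify over an arbitrary Poitou–Tate family `inv : LocalInvariants K (p^k)` with `IsPerfect`, `SumLocalTermEqZero`,
`SelmerComplement`.  For THE canonical family `LocalInvariants.canonical K (p^k)` the first two are tree THEOREMS (local Tate duality
`LocalInvariants.canonical_isPerfect`; the reciprocity law `sumInvLocalizationEqZero_canonical_of_numberField` +
`sumLocalTermEqZero_of_sumInvLocalizationEqZero`), so only `SelmerComplement` (Poitou–Tate, Milne I 4.10(b) `⊇`) remains: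

* **`exists_forall_le_natCard_selmerGroup_relaxed_eq_canonical_intPow`** (any `K : Type`): `[Finite (W.selmerGroupPInfty p)]` and
  `∀ k, (canonical K (p^k)).SelmerComplement` ⟹ `∃ k₀ ∀ k ≥ k₀` ∀ Kato pairs `𝓢 ≤ ℛ` on `W.torsionGaloisModule ((p:ℤ)^k)`:
  `#H¹_ℛ(K,E[p^k]) = #Sel_str^{ur}(K,E[p^∞]) · ∏_{v∈P} #𝓚_v`.
* **`exists_forall_le_natCard_selmerGroup_relaxed_le_sha_points_rat_canonical`** (`K = ℚ`): rank `0`, `Ш(E/ℚ)[p^∞]` finite,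
  finite `I_ℓ`-fixed points at `ℓ ∈ T∖{v_p}`, `∀ k, (canonical ℚ (p^k)).SelmerComplement` ⟹ for `k ≥ k₀` and all Kato pairs:
  `#H¹_ℛ(ℚ,E[p^k]) ≤ #Ш(E/ℚ)[p^∞] · ∏_{ℓ∈T∖{v_p}} #E(ℚ_ℓ)[p^∞] · #E(ℚ_p)[p^k] · p^k`.

References: K. Kato, Astérisque 295 (2004) (14.9.3), Prop. 14.16 (2) [Kato2004Asterisque]; J. S. Milne, *ADT* I Thm. 4.10 [MilneADT2006].
-/

-- the summit and its single problem are both named `BirchSwinnertonDyer` (registry layout D-0017)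
set_option linter.dupNamespace false
set_option autoImplicit false

noncomputable section

open scoped Classical ContRepresentation NumberField
open Function Field NumberField IsDedekindDomain WeierstrassCurve
open Literature.NumberTheory.EllipticCurves Literature.NumberTheory.GaloisRepresentations
  Literature.NumberTheory.GaloisRepresentations.DiscreteGaloisModule Literature.NumberTheory.GaloisCohomology
open Literature.NumberTheory.EllipticCurves.Kato2004
open Summit.BirchSwinnertonDyer.Rank1Residual.X11b.LocBridge

namespace Summit.BirchSwinnertonDyer.BirchSwinnertonDyer.Theorems.KatoFiniteLevelCount

section Canonical

variable {K : Type} [Field K] [NumberField K] (W : WeierstrassCurve K) [W.IsElliptic] (p : ℕ) [Fact p.Prime]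

/-- **Kato's (14.9.3) count for THE invariant maps** (`K : Type`, `Kato2004` level dialect): granted `SelmerComplement` of
`LocalInvariants.canonical K (p^k)` for all `k` and `[Finite (W.selmerGroupPInfty p)]`, `∃ k₀ ∀ k ≥ k₀`, every Kato pair `𝓢 ≤ ℛ`
on `W.torsionGaloisModule ((p:ℤ)^k)` has `#H¹_ℛ = #Sel_str^{ur}(K,E[p^∞]) · ∏_{v∈P} #𝓚_v`.
[cite: Kato2004Asterisque, (14.9.3)–(14.9.4) (p. 240) and Prop. 14.16 (p. 244)] [cite: MilneADT2006, Ch. I, Thm. 4.10] -/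
theorem exists_forall_le_natCard_selmerGroup_relaxed_eq_canonical_intPow (hodd : p ≠ 2)
    (P T : Finset (HeightOneSpectrum (𝓞 K)))
    (hPT : P ⊆ T) (hT : ∀ v : HeightOneSpectrum (𝓞 K), v ∉ T → (p : 𝓞 K) ∉ v.asIdeal ∧ W.HasGoodReductionAt v)
    (hPp : ∀ v : HeightOneSpectrum (𝓞 K), (p : 𝓞 K) ∈ v.asIdeal → v ∈ P)
    (𝓢inf : SelmerStructure (primaryGaloisModule W p)) [Finite (W.selmerGroupPInfty p)]
    (hIP : ∀ v ∈ P, 𝓢inf (Sum.inr v) = ⊥)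
    (hIur : ∀ v ∉ P, 𝓢inf (Sum.inr v) = unramifiedSubgroup (GaloisRep.toLocal v (primaryGaloisModule W p)) 1)
    (hIinl : ∀ w : InfinitePlace K, 𝓢inf (Sum.inl w) = ⊤) {v₀ : HeightOneSpectrum (𝓞 K)} (hv₀P : v₀ ∈ P)
    (hSC : ∀ k : ℕ, (LocalInvariants.canonical K (p ^ k)).SelmerComplement) :
    ∃ k₀ : ℕ, ∀ k, k₀ ≤ k →
      ∀ (𝓢 ℛ : SelmerStructure (W.torsionGaloisModule ((p : ℤ) ^ k))),
        (∀ v ∈ P, 𝓢 (Sum.inr v) = ⊥) → (∀ v ∈ P, ℛ (Sum.inr v) = ⊤) →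
        (∀ v ∉ P, 𝓢 (Sum.inr v) = unramifiedSubgroup (GaloisRep.toLocal v (W.torsionGaloisModule ((p : ℤ) ^ k))) 1) →
        (∀ v ∉ P, ℛ (Sum.inr v) = unramifiedSubgroup (GaloisRep.toLocal v (W.torsionGaloisModule ((p : ℤ) ^ k))) 1) →
        Nat.card ℛ.selmerGroup =
          Nat.card 𝓢inf.selmerGroup * ∏ v ∈ P, Nat.card (W.kummerSelmerStructure ((p : ℤ) ^ k) (Sum.inr v)) := by
  obtain ⟨k₀, hk₀⟩ := exists_forall_le_natCard_selmerGroup_relaxed_eq_of_finite_selmerGroupPInfty_intPow W p hodd P T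
    hPT hT hPp 𝓢inf hIP hIur hIinl hv₀P
  refine ⟨k₀, fun k hk 𝓢 ℛ h𝓢P hℛP h𝓢ur hℛur => ?_⟩
  exact hk₀ k hk (LocalInvariants.canonical K (p ^ k)) LocalInvariants.canonical_isPerfect
    ((LocalInvariants.canonical K (p ^ k)).sumLocalTermEqZero_of_sumInvLocalizationEqZero
      (sumInvLocalizationEqZero_canonical_of_numberField K (p ^ k))) (hSC k) 𝓢 ℛ h𝓢P hℛP h𝓢ur hℛur

/-- **Kato's Prop. 14.16 (2), kernel half, over `ℚ`, for THE invariant maps**: `E/ℚ`, `p` odd, rank `0`, `Ш(E/ℚ)[p^∞]` finite,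
`T ∋ v_p` with good reduction outside, `I_ℓ`-fixed points of `E[p^∞]` finite at `ℓ ∈ T ∖ {v_p}`, and `SelmerComplement` for
`LocalInvariants.canonical ℚ (p^k)` (all `k`): for `k ≥ k₀` and every Kato pair `𝓢 ≤ ℛ` on `W.torsionGaloisModule ((p:ℤ)^k)`,
**`#H¹_ℛ(ℚ,E[p^k]) ≤ #Ш(E/ℚ)[p^∞] · ∏_{ℓ∈T∖{v_p}} #E(ℚ_ℓ)[p^∞] · #E(ℚ_p)[p^k] · p^k`**.
[cite: Kato2004Asterisque, §14.8 (p. 238), (14.9.3) (p. 240), Prop. 14.16 (2) (p. 244)] [cite: MilneADT2006, Ch. I, Thm. 4.10] -/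
theorem exists_forall_le_natCard_selmerGroup_relaxed_le_sha_points_rat_canonical (W : WeierstrassCurve ℚ) [W.IsElliptic]
    (hodd : p ≠ 2) (T : Finset (HeightOneSpectrum (𝓞 ℚ))) (hpT : primePlace p ∈ T)
    (hT : ∀ v : HeightOneSpectrum (𝓞 ℚ), v ∉ T → W.HasGoodReductionAt v)
    (hI : ∀ v ∈ T \ {primePlace p}, Set.Finite {x : W.geomPrimaryTorsion p |
      ∀ τ ∈ absInertia (v.adicCompletion ℚ), GaloisRep.toLocal v (primaryGaloisModule W p) τ x = x})
    (𝓢inf 𝓢zero : SelmerStructure (primaryGaloisModule W p)) [Finite W.toAffine.Point]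
    [Finite (AddCommGroup.primaryComponent W.sha p)]
    (hIP : 𝓢inf (Sum.inr (primePlace p)) = ⊥)
    (hIur : ∀ v : HeightOneSpectrum (𝓞 ℚ), v ≠ primePlace p →
      𝓢inf (Sum.inr v) = unramifiedSubgroup (GaloisRep.toLocal v (primaryGaloisModule W p)) 1)
    (hIinl : ∀ w : InfinitePlace ℚ, 𝓢inf (Sum.inl w) = ⊤)
    (h0T : ∀ v ∈ T, 𝓢zero (Sum.inr v) = ⊥)
    (h0ur : ∀ v ∉ T, 𝓢zero (Sum.inr v) = unramifiedSubgroup (GaloisRep.toLocal v (primaryGaloisModule W p)) 1)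
    (h0inl : ∀ w : InfinitePlace ℚ, 𝓢zero (Sum.inl w) = ⊤)
    (hSC : ∀ k : ℕ, (LocalInvariants.canonical ℚ (p ^ k)).SelmerComplement) :
    ∃ k₀ : ℕ, ∀ k, k₀ ≤ k →
      ∀ (𝓢 ℛ : SelmerStructure (W.torsionGaloisModule ((p : ℤ) ^ k))),
        𝓢 (Sum.inr (primePlace p)) = ⊥ → ℛ (Sum.inr (primePlace p)) = ⊤ →
        (∀ v : HeightOneSpectrum (𝓞 ℚ), v ≠ primePlace p →
          𝓢 (Sum.inr v) = unramifiedSubgroup (GaloisRep.toLocal v (W.torsionGaloisModule ((p : ℤ) ^ k))) 1) →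
        (∀ v : HeightOneSpectrum (𝓞 ℚ), v ≠ primePlace p →
          ℛ (Sum.inr v) = unramifiedSubgroup (GaloisRep.toLocal v (W.torsionGaloisModule ((p : ℤ) ^ k))) 1) →
        Nat.card ℛ.selmerGroup ≤
          Nat.card (AddCommGroup.primaryComponent W.sha p) *
            (∏ v ∈ T \ {primePlace p},
              Nat.card (AddCommGroup.primaryComponent (W.baseChange (v.adicCompletion ℚ)).toAffine.Point p)) *
            (Nat.card (nsmulAddMonoidHom (p ^ k) :
              (W.baseChange ((primePlace p).adicCompletion ℚ)).toAffine.Point →+ _).ker * p ^ k) := by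
  obtain ⟨k₀, hk₀⟩ := exists_forall_le_natCard_selmerGroup_relaxed_le_sha_points_rat_intPow p W hodd T hpT hT hI 𝓢inf
    𝓢zero hIP hIur hIinl h0T h0ur h0inl
  refine ⟨k₀, fun k hk 𝓢 ℛ h𝓢P hℛP h𝓢ur hℛur => ?_⟩
  exact hk₀ k hk (LocalInvariants.canonical ℚ (p ^ k)) LocalInvariants.canonical_isPerfect
    ((LocalInvariants.canonical ℚ (p ^ k)).sumLocalTermEqZero_of_sumInvLocalizationEqZero
      (sumInvLocalizationEqZero_canonical_of_numberField ℚ (p ^ k))) (hSC k) 𝓢 ℛ h𝓢P hℛP h𝓢ur hℛur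

end Canonical

end Summit.BirchSwinnertonDyer.BirchSwinnertonDyer.Theorems.KatoFiniteLevelCount

end
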